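/-
Copyright (c) 2026. All rights reserved.
Released under Apache 2.0 license as described in the file LICENSE.
Authors: abc-iut cell, block C / W6 prover seat abc-iut-w6-d060 (gen 2).
-/
import Mathlib.FieldTheory.Finite.Basic
import Mathlib.GroupTheory.SpecificGroups.Cyclic.Basic
import Mathlib.Data.Int.GCD
import Literature.IUT.LogVolume.LogUnitsRootTwist
import Literature.IUT.LogVolume.RamificationInvariants
import HarnessLib

/-!
# `log_p(𝒪_K^×)` at the BOUNDARY ramification index `e = p − 1` (`p` odd): the trichotomy

Classical `p`-adic analysis (Serre, *Local Fields* IV §2; Washington, *Cyclotomic Fields* Lemma 1.4 /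
§5.1; Koblitz Ch. IV §1–2; Neukirch ANT II (5.5)–(5.7)).  [IUTchIV] Prop. 1.2 (i) (tree:
`prop12i_holds`, `prop12iEq_holds`) computes `log_p(𝒪_K^×) = 𝔪_K` exactly only in the TAME range
`e ≤ p − 2`; for `e ≥ p − 1` it gives inclusions.  This PROOF-ONLY file (no `def`, no named fact) settles
the boundary case `e = p − 1`, `p` odd, for an arbitrary finite extension `K` of `ℚ_p` in the cell's
setting (`K` a complete = proper ultrametric normed `ℚ_p`-algebra; `absRamificationIdx p K = p − 1`,
uniformizer `ϖ`, `r := ‖ϖ‖ = p^{−1/(p−1)}`):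

* sandwich: `𝔪² = {‖z‖ ≤ r²} ⊆ log_p(𝒪^×) ⊆ {‖z‖ ≤ r} = 𝔪` (`closedBall_sq_subset_logUnits`,
  `logUnits_subset_closedBall`);
* KEY CONGRUENCE: for `‖a‖ ≤ 1`, `log_p(1 + ϖa) ≡ ϖ·(a + c·a^p) (mod 𝔪²)` with the UNIT
  `c := ϖ^{p−1}/p` (`norm_logSeries_one_add_sub_le`): modulo `𝔪²` the logarithm is the ADDITIVE
  polynomial `ā ↦ ā + c̄·ā^p` on the residue field `k = 𝒪/𝔪`;
* (W1) if `K` has NO non-trivial `p`-th root of unity then `log_p(𝒪^×) = 𝔪` — exactly as in the tame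
  range (`logUnits_eq_closedBall_of_forall_pow_prime_eq_one`);
* (W2) if `ζ_p ∈ K` and the residue degree is `f = 1` (so `K ≅ ℚ_p(ζ_p)`) then `log_p(𝒪^×) = 𝔪²`
  (`logUnits_eq_closedBall_sq_of_residueDegree_eq_one`; the local, intrinsic form of the tree's global
  cyclotomic computation `UnitLogCyclotomicPrime.logUnits_eq_closedBall_sq`);
* (W3) if `ζ_p ∈ K` and `f ≥ 2` then `log_p(𝒪^×)` is NOT an `𝒪_K`-submodule of `K`: it lies strictly
  between `𝔪²` and `𝔪` and is not stable under multiplication by `𝒪` (`exists_mul_not_mem_logUnits`);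
  consequently NO ball `{‖z‖ ≤ s}` equals `c • log_p(𝒪^×)` for a non-zero scalar `c ∈ ℚ_p`
  (`closedBall_ne_smul_logUnits`) — the input of the Dupuy–Hilado (Ind2) ball-mover criterion
  (`Summits/ABC/IUTFork/Thm311RealIsmDHMoverCriterion`, abc-iut-w5-d180) at such places.

Non-trivial `p`-th roots of unity enter through: `log_p ζ = 0`, `‖ζ − 1‖ = r` exactly (so the class
of `(ζ−1)/ϖ` is a non-zero zero of `ā ↦ ā + c̄·ā^p`), and conversely a unit zero of that polynomial
LIFTS to a non-trivial `p`-th root of unity (`exists_pow_prime_eq_one_of_norm_add_mul_pow_lt_one`).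
No exponential series is used: surjectivity/injectivity of `log_p : 1 + 𝔪² ≅ 𝔪²` are the tree's
`exists_logSeries_eq` / `logSeries_injOn` (campaign-S `LogSeriesEstimates`).

References: [cite: NeukirchANT1999, Ch. II Prop. (5.5)–(5.7)] [cite: Koblitz1984, Ch. IV §1–2]
[cite: Washington1997, Lemma 1.4, §5.1].  Nothing here is disputed mathematics; the name
`logUnits` is the cell's typing of [IUTchIV] Prop. 1.2's `log_p(R^×)`
([claim: Mochizuki2012, status: disputed] for that locution only).
-/

noncomputable section

open Metric Set IsUltrametricDist IsLocalRing
open scoped Pointwise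

namespace Literature.IUT.LogVolume

open Literature.NumberTheory.GaloisRepresentations.Ultrametric

namespace BoundaryRamification

/-! ## 0. Arithmetic: `(p − 1)·v_p(N) + 2 ≤ N` for `N ≥ 2`, `N ≠ p` -/

/-- `q·v + 1 ≤ (q+1)^v` (Bernoulli). [cite: Koblitz1984, Ch. IV §1] -/
theorem mul_add_one_le_succ_pow (q v : ℕ) : q * v + 1 ≤ (q + 1) ^ v := by
  induction v with
  | zero => simp
  | succ v ih =>
    have h1 : 1 ≤ (q + 1) ^ v := Nat.one_le_pow _ _ (Nat.succ_pos q)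
    calc q * (v + 1) + 1 = (q * v + 1) + q := by ring
      _ ≤ (q + 1) ^ v + q * (q + 1) ^ v := Nat.add_le_add ih (Nat.le_mul_of_pos_right _ h1)
      _ = (q + 1) ^ (v + 1) := by ring

/-- `q·v + 2 ≤ (q+1)^v` for `v ≥ 2`, `q ≥ 1`. [cite: Koblitz1984, Ch. IV §1] -/
theorem mul_add_two_le_succ_pow {q : ℕ} (hq : 1 ≤ q) {v : ℕ} (hv : 2 ≤ v) :
    q * v + 2 ≤ (q + 1) ^ v := by
  induction v, hv using Nat.le_induction with
  | base => nlinarith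
  | succ v hv ih =>
    have h1 : 1 ≤ (q + 1) ^ v := Nat.one_le_pow _ _ (Nat.succ_pos q)
    calc q * (v + 1) + 2 = (q * v + 2) + q := by ring
      _ ≤ (q + 1) ^ v + q * (q + 1) ^ v := Nat.add_le_add ih (Nat.le_mul_of_pos_right _ h1)
      _ = (q + 1) ^ (v + 1) := by ring

/-- **`(p − 1)·v_p(N) + 2 ≤ N` for every `N ≥ 2` other than `N = p`** (for `N = p^v·m`: `m ≥ 2` by
Bernoulli, `m = 1` forces `v ≥ 2`). This is the exponent inequality behind "every term of the logarithmic
series except `x` and `x^p/p` is `O(ϖ²)` at `e = p − 1`". [cite: Koblitz1984, Ch. IV §1] -/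
theorem sub_one_mul_padicValNat_add_two_le {p : ℕ} [hp : Fact p.Prime] {N : ℕ} (h2 : 2 ≤ N)
    (hN : N ≠ p) : (p - 1) * padicValNat p N + 2 ≤ N := by
  have hp2 : 2 ≤ p := hp.out.two_le
  set v := padicValNat p N with hv
  obtain ⟨m, hm⟩ : p ^ v ∣ N := pow_padicValNat_dvd
  have hN0 : N ≠ 0 := by omega
  have hm0 : m ≠ 0 := by rintro rfl; simp at hm; exact hN0 hm
  rcases Nat.lt_or_ge m 2 with hm2 | hm2
  · -- `m = 1`, `N = p^v`, `v ≥ 2`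
    have hm1 : m = 1 := by omega
    rw [hm1, mul_one] at hm
    have hv2 : 2 ≤ v := by
      by_contra hlt
      rw [not_le] at hlt
      interval_cases v
      · rw [pow_zero] at hm; omega
      · rw [pow_one] at hm; exact hN hm
    rw [hm]
    have h := mul_add_two_le_succ_pow (q := p - 1) (by omega) hv2
    rwa [Nat.sub_add_cancel (by omega : 1 ≤ p)] at h
  · -- `m ≥ 2`
    have h1 := mul_add_one_le_succ_pow (p - 1) v
    rw [Nat.sub_add_cancel (by omega : 1 ≤ p)] at h1
    calc (p - 1) * v + 2 ≤ 2 * ((p - 1) * v + 1) := by omega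
      _ ≤ m * p ^ v := Nat.mul_le_mul hm2 h1
      _ = N := by rw [hm, mul_comm]

end BoundaryRamification

open BoundaryRamification

variable (p : ℕ) [hp : Fact p.Prime]
variable {K : Type*} [NontriviallyNormedField K] [instK : NormedAlgebra ℚ_[p] K] [IsUltrametricDist K]
  [ProperSpace K]

namespace BoundaryRamification

/-! ## 1. Norm bookkeeping at `e = p − 1`: `r := ‖ϖ‖`, `r^{p−1} = ‖p‖ = p⁻¹`, `r·p^{1/(p−1)} = 1` -/

section Norms

variable {ϖ : Kˣ} (hϖ : IsUniformizer ϖ) (he : absRamificationIdx p K = p - 1)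
include hϖ he

/-- `‖p‖ = ‖ϖ‖^{p−1}` at `e = p − 1`. [cite: NeukirchANT1999, Ch. II Prop. (5.5)] -/
theorem norm_prime_eq_norm_pow_sub_one : ‖(p : K)‖ = ‖(ϖ : K)‖ ^ (p - 1) := by
  rw [norm_prime_eq_norm_pow p K hϖ, he]

/-- `‖ϖ‖^{p−1} = p⁻¹` at `e = p − 1`. [cite: NeukirchANT1999, Ch. II Prop. (5.5)] -/
theorem norm_pow_sub_one_eq_inv : ‖(ϖ : K)‖ ^ (p - 1) = (p : ℝ)⁻¹ := by
  rw [← he]; exact norm_pow_absRamificationIdx p K hϖ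

/-- `‖ϖ‖ · p^{1/(p−1)} = 1` at `e = p − 1` (the contraction modulus of the tree's `LogSeriesEstimates` at
radius `‖ϖ‖` is exactly `1`). [cite: Koblitz1984, Ch. IV §1] -/
theorem norm_mul_rpow_eq_one : ‖(ϖ : K)‖ * (p : ℝ) ^ (1 / ((p : ℝ) - 1)) = 1 := by
  have hp1 : (1 : ℝ) < p := by exact_mod_cast hp.out.one_lt
  have hp0 : (0 : ℝ) < p := by linarith
  have hcast : ((absRamificationIdx p K : ℕ) : ℝ) = (p : ℝ) - 1 := by
    rw [he, Nat.cast_sub hp.out.one_lt.le, Nat.cast_one]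
  rw [norm_eq_rpow_of_isUniformizer p K hϖ, hcast, ← Real.rpow_add hp0, neg_add_cancel, Real.rpow_zero]

/-- `‖ϖ‖² · p^{1/(p−1)} = ‖ϖ‖ < 1`: at radius `‖ϖ‖²` the logarithmic series contracts strictly.
[cite: Koblitz1984, Ch. IV §2] -/
theorem sq_mul_rpow_lt_one : ‖(ϖ : K)‖ ^ 2 * (p : ℝ) ^ (1 / ((p : ℝ) - 1)) < 1 := by
  rw [pow_two, mul_assoc, norm_mul_rpow_eq_one p hϖ he, mul_one]
  exact hϖ.norm_lt_one

end Norms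

/-! ## 2. The terms of the logarithmic series at `e = p − 1` and the KEY CONGRUENCE -/

section KeyCongruence

variable {ϖ : Kˣ} (hϖ : IsUniformizer ϖ) (he : absRamificationIdx p K = p - 1)
include hϖ he

/-- **Term estimate**: for `‖1 − y‖ ≤ ‖ϖ‖` and `N = n + 1 ∉ {1, p}`, the `N`-th term of `L(y)` has norm
`≤ ‖ϖ‖²` (`‖(1−y)^N/N‖ = ‖1−y‖^N·p^{v_p(N)} ≤ ‖ϖ‖^{N − (p−1)v_p(N)} ≤ ‖ϖ‖²`). [cite: Koblitz1984, Ch. IV §1] -/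
theorem norm_logTerm_le_sq {y : K} (hy : ‖1 - y‖ ≤ ‖(ϖ : K)‖) {n : ℕ} (hn0 : n ≠ 0)
    (hnp : n + 1 ≠ p) : ‖-((1 - y) ^ (n + 1)) / (n + 1 : K)‖ ≤ ‖(ϖ : K)‖ ^ 2 := by
  set r := ‖(ϖ : K)‖ with hr
  have hr0 : 0 < r := norm_units_pos ϖ
  have hr1 : r < 1 := hϖ.norm_lt_one
  have harith := sub_one_mul_padicValNat_add_two_le (p := p) (N := n + 1) (by omega) hnp
  set v := padicValNat p (n + 1) with hv
  rw [norm_logTerm_eq p K y n]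
  have hpinv : r ^ (p - 1) = (p : ℝ)⁻¹ := by rw [hr]; exact norm_pow_sub_one_eq_inv p hϖ he
  have hpv : (p : ℝ) ^ v = (r ^ (p - 1))⁻¹ ^ v := by rw [hpinv, inv_inv]
  calc ‖1 - y‖ ^ (n + 1) * (p : ℝ) ^ v ≤ r ^ (n + 1) * (p : ℝ) ^ v := by gcongr
    _ = r ^ ((n + 1 : ℕ) : ℤ) * (r ^ (((p - 1) * v : ℕ) : ℤ))⁻¹ := by
        rw [hpv, zpow_natCast, zpow_natCast, inv_pow, pow_mul]
    _ = r ^ (((n + 1 : ℕ) : ℤ) - (((p - 1) * v : ℕ) : ℤ)) := by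
        rw [zpow_sub₀ hr0.ne', div_eq_mul_inv]
    _ ≤ r ^ (2 : ℤ) := zpow_le_zpow_right_of_le_one₀ hr0 hr1.le (by omega)
    _ = r ^ 2 := zpow_ofNat r 2

/-- **KEY CONGRUENCE** `log_p(1 + x) ≡ x + x^p/p (mod 𝔪²)` for `x ∈ 𝔪` at `e = p − 1`, `p` odd:
`‖L(1 + x) − x − x^p/p‖ ≤ ‖ϖ‖²` (all other terms of the series are `O(ϖ²)`, `norm_logTerm_le_sq`).
[cite: Koblitz1984, Ch. IV §1] [cite: Washington1997, §5.1] -/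
theorem norm_logSeries_sub_sub_le (hp2 : p ≠ 2) {x : K} (hx : ‖x‖ ≤ ‖(ϖ : K)‖) :
    ‖logSeries (1 + x) - x - x ^ p / p‖ ≤ ‖(ϖ : K)‖ ^ 2 := by
  set r := ‖(ϖ : K)‖ with hr
  have hr1 : r < 1 := hϖ.norm_lt_one
  have hp3 : 3 ≤ p := by
    have := hp.out.two_le
    omega
  set y : K := 1 + x with hy
  have hxy : 1 - y = -x := by rw [hy]; ring
  have hy1 : ‖1 - y‖ < 1 := by rw [hxy, norm_neg]; exact hx.trans_lt hr1
  set f : ℕ → K := fun n ↦ -((1 - y) ^ (n + 1)) / (n + 1 : K) with hf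
  have hsum : HasSum f (logSeries y) := hasSum_logSeries p hy1
  -- the two distinguished terms
  have hf0 : f 0 = x := by
    simp only [hf, hxy, zero_add, pow_one, neg_neg, Nat.cast_zero, div_one]
  have hodd : Odd p := hp.out.odd_of_ne_two hp2
  have hfp : f (p - 1) = x ^ p / p := by
    simp only [hf, hxy]
    have h1 : p - 1 + 1 = p := by omega
    rw [h1, Odd.neg_pow hodd, neg_neg]
    congr 1
    have : ((p - 1 : ℕ) : K) + 1 = ((p - 1 + 1 : ℕ) : K) := by push_cast; ring
    rw [this, h1]
  -- split the sum
  set s : Finset ℕ := {0, p - 1} with hs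
  have h0p : (0 : ℕ) ≠ p - 1 := by omega
  have hsplit := hsum.summable.sum_add_tsum_compl (s := s)
  rw [hsum.tsum_eq] at hsplit
  have hssum : ∑ n ∈ s, f n = x + x ^ p / p := by
    rw [hs, Finset.sum_pair h0p, hf0, hfp]
  have hrest : logSeries y - x - x ^ p / p = ∑' n : ↥((s : Set ℕ)ᶜ), f n := by
    rw [← hsplit, hssum]; ring
  rw [hrest]
  refine IsUltrametricDist.norm_tsum_le_of_forall_le_of_nonneg (by positivity) fun n ↦ ?_
  have hn : (n : ℕ) ∉ ({0, p - 1} : Finset ℕ) := by rw [← hs]; exact n.2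
  rw [Finset.mem_insert, Finset.mem_singleton, not_or] at hn
  exact norm_logTerm_le_sq p hϖ he (by rw [hxy, norm_neg]; exact hx) hn.1 (by omega)

/-- The unit `c := ϖ^{p−1}/p` has norm `1`. [cite: Washington1997, §5.1] -/
theorem norm_coeff_eq_one : ‖(ϖ : K) ^ (p - 1) / p‖ = 1 := by
  rw [norm_div, norm_pow, ← norm_prime_eq_norm_pow_sub_one p hϖ he]
  exact div_self (norm_pos_iff.mpr (prime_ne_zero p K)).ne'

omit [IsUltrametricDist K] [ProperSpace K] hϖ he in
/-- `x + x^p/p = ϖ·(a + c·a^p)` for `x = ϖa`, `c = ϖ^{p−1}/p`. [cite: Washington1997, §5.1] -/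
theorem mul_add_pow_div_eq (a : K) :
    (ϖ : K) * a + ((ϖ : K) * a) ^ p / p = (ϖ : K) * (a + (ϖ : K) ^ (p - 1) / p * a ^ p) := by
  have hp1 : p = (p - 1) + 1 := (Nat.sub_add_cancel hp.out.one_lt.le).symm
  have hp0 : (p : K) ≠ 0 := prime_ne_zero p K
  conv_lhs => rw [mul_pow, hp1, pow_succ]
  rw [← hp1]
  field_simp

/-- **KEY CONGRUENCE, `Λ`-form**: for `‖a‖ ≤ 1`, `‖L(1 + ϖa) − ϖ·(a + c·a^p)‖ ≤ ‖ϖ‖²` with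
`c = ϖ^{p−1}/p`: modulo `𝔪²`, `log_p` on `1 + 𝔪` is the additive polynomial `ā ↦ ā + c̄·ā^p` of the residue
field. [cite: Washington1997, §5.1] [cite: Koblitz1984, Ch. IV §1] -/
theorem norm_logSeries_one_add_sub_le (hp2 : p ≠ 2) {a : K} (ha : ‖a‖ ≤ 1) :
    ‖logSeries (1 + (ϖ : K) * a) - (ϖ : K) * (a + (ϖ : K) ^ (p - 1) / p * a ^ p)‖ ≤ ‖(ϖ : K)‖ ^ 2 := by
  have hx : ‖(ϖ : K) * a‖ ≤ ‖(ϖ : K)‖ := by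
    rw [norm_mul]; exact mul_le_of_le_one_right (norm_nonneg _) ha
  have h := norm_logSeries_sub_sub_le p hϖ he hp2 hx
  rwa [sub_sub, mul_add_pow_div_eq p a] at h

/-- If `‖a‖ ≤ 1` and `a + c·a^p ∈ 𝔪` then `log_p(1 + ϖa) ∈ 𝔪²`. [cite: Washington1997, §5.1] -/
theorem norm_logSeries_le_sq_of_norm_lt_one (hp2 : p ≠ 2) {a : K} (ha : ‖a‖ ≤ 1)
    (hΛ : ‖a + (ϖ : K) ^ (p - 1) / p * a ^ p‖ < 1) :
    ‖logSeries (1 + (ϖ : K) * a)‖ ≤ ‖(ϖ : K)‖ ^ 2 := by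
  have h := norm_logSeries_one_add_sub_le p hϖ he hp2 ha
  have hΛ' : ‖(ϖ : K) * (a + (ϖ : K) ^ (p - 1) / p * a ^ p)‖ ≤ ‖(ϖ : K)‖ ^ 2 := by
    rw [norm_mul, pow_two]
    exact mul_le_mul_of_nonneg_left (hϖ.norm_le_of_norm_lt_one _ hΛ) (norm_nonneg _)
  have := norm_add_le_max (logSeries (1 + (ϖ : K) * a) - (ϖ : K) * (a + (ϖ : K) ^ (p - 1) / p * a ^ p))
    ((ϖ : K) * (a + (ϖ : K) ^ (p - 1) / p * a ^ p))
  rw [sub_add_cancel] at this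
  exact this.trans (max_le h hΛ')

/-- Conversely, if `‖a‖ ≤ 1` and `log_p(1 + ϖa) ∈ 𝔪²` then `a + c·a^p ∈ 𝔪`. [cite: Washington1997, §5.1] -/
theorem norm_lt_one_of_norm_logSeries_le_sq (hp2 : p ≠ 2) {a : K} (ha : ‖a‖ ≤ 1)
    (hL : ‖logSeries (1 + (ϖ : K) * a)‖ ≤ ‖(ϖ : K)‖ ^ 2) :
    ‖a + (ϖ : K) ^ (p - 1) / p * a ^ p‖ < 1 := by
  have hr0 : 0 < ‖(ϖ : K)‖ := norm_units_pos ϖ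
  have h := norm_logSeries_one_add_sub_le p hϖ he hp2 ha
  have h2 : ‖(ϖ : K) * (a + (ϖ : K) ^ (p - 1) / p * a ^ p)‖ ≤ ‖(ϖ : K)‖ ^ 2 := by
    have := norm_add_le_max (logSeries (1 + (ϖ : K) * a))
      (-(logSeries (1 + (ϖ : K) * a) - (ϖ : K) * (a + (ϖ : K) ^ (p - 1) / p * a ^ p)))
    rw [norm_neg, ← sub_eq_add_neg, sub_sub_cancel] at this
    exact this.trans (max_le hL h)
  rw [norm_mul, pow_two] at h2
  have h3 : ‖a + (ϖ : K) ^ (p - 1) / p * a ^ p‖ ≤ ‖(ϖ : K)‖ := le_of_mul_le_mul_left h2 hr0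
  exact h3.trans_lt hϖ.norm_lt_one

/-- More generally: for `‖a‖, ‖b‖ ≤ 1`, `log_p(1 + ϖa) ≡ ϖb (mod 𝔪²)` iff `a + c·a^p ≡ b (mod 𝔪)`;
here the direction used below. [cite: Washington1997, §5.1] -/
theorem norm_logSeries_sub_mul_le_sq_of_norm_sub_lt_one (hp2 : p ≠ 2) {a b : K} (ha : ‖a‖ ≤ 1)
    (hab : ‖a + (ϖ : K) ^ (p - 1) / p * a ^ p - b‖ < 1) :
    ‖logSeries (1 + (ϖ : K) * a) - (ϖ : K) * b‖ ≤ ‖(ϖ : K)‖ ^ 2 := by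
  have h := norm_logSeries_one_add_sub_le p hϖ he hp2 ha
  have h2 : ‖(ϖ : K) * (a + (ϖ : K) ^ (p - 1) / p * a ^ p) - (ϖ : K) * b‖ ≤ ‖(ϖ : K)‖ ^ 2 := by
    rw [← mul_sub, norm_mul, pow_two]
    exact mul_le_mul_of_nonneg_left (hϖ.norm_le_of_norm_lt_one _ hab) (norm_nonneg _)
  have := norm_add_le_max (logSeries (1 + (ϖ : K) * a) - (ϖ : K) * (a + (ϖ : K) ^ (p - 1) / p * a ^ p))
    ((ϖ : K) * (a + (ϖ : K) ^ (p - 1) / p * a ^ p) - (ϖ : K) * b)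
  rw [sub_add_sub_cancel] at this
  exact this.trans (max_le h h2)

/-- And the converse direction. [cite: Washington1997, §5.1] -/
theorem norm_sub_lt_one_of_norm_logSeries_sub_mul_le_sq (hp2 : p ≠ 2) {a b : K} (ha : ‖a‖ ≤ 1)
    (hL : ‖logSeries (1 + (ϖ : K) * a) - (ϖ : K) * b‖ ≤ ‖(ϖ : K)‖ ^ 2) :
    ‖a + (ϖ : K) ^ (p - 1) / p * a ^ p - b‖ < 1 := by
  have hr0 : 0 < ‖(ϖ : K)‖ := norm_units_pos ϖ
  have h := norm_logSeries_one_add_sub_le p hϖ he hp2 ha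
  have h2 : ‖(ϖ : K) * (a + (ϖ : K) ^ (p - 1) / p * a ^ p) - (ϖ : K) * b‖ ≤ ‖(ϖ : K)‖ ^ 2 := by
    have := norm_add_le_max (logSeries (1 + (ϖ : K) * a) - (ϖ : K) * b)
      (-(logSeries (1 + (ϖ : K) * a) - (ϖ : K) * (a + (ϖ : K) ^ (p - 1) / p * a ^ p)))
    rw [norm_neg, ← sub_eq_add_neg, sub_sub_sub_cancel_left] at this
    exact this.trans (max_le hL h)
  rw [← mul_sub, norm_mul, pow_two] at h2
  exact (le_of_mul_le_mul_left h2 hr0).trans_lt hϖ.norm_lt_one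

end KeyCongruence

/-! ## 3. The sandwich `𝔪² ⊆ log_p(𝒪^×) ⊆ 𝔪` at `e = p − 1` -/

section Sandwich

variable {ϖ : Kˣ} (hϖ : IsUniformizer ϖ) (he : absRamificationIdx p K = p - 1)
include hϖ he

/-- At `e = p − 1` the logarithmic series is `1`-Lipschitz on ALL principal units:
`‖L(y)‖ ≤ ‖1 − y‖` for `‖1 − y‖ < 1` (contraction modulus `‖ϖ‖·p^{1/(p−1)} = 1`).
[cite: Koblitz1984, Ch. IV §1] -/
theorem norm_logSeries_le_of_isPrincipal {y : K} (hy : IsPrincipal y) : ‖logSeries y‖ ≤ ‖1 - y‖ :=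
  norm_logSeries_le_norm p K (le_of_eq (norm_mul_rpow_eq_one p hϖ he)) (hϖ.norm_le_of_norm_lt_one _ hy)

/-- **Upper half of the sandwich: `log_p(𝒪^×) ⊆ 𝔪 = {‖z‖ ≤ ‖ϖ‖}`** at `e = p − 1` (for a unit `u`,
`log_p u = m⁻¹·L(u^m)` with `p ∤ m`, `u^m` principal, and `‖L(u^m)‖ ≤ ‖1 − u^m‖ ≤ ‖ϖ‖`).
[cite: NeukirchANT1999, Ch. II Prop. (5.5)] -/
theorem logUnits_subset_closedBall : logUnits K ⊆ closedBall (0 : K) ‖(ϖ : K)‖ := by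
  rintro _ ⟨u, hu, rfl⟩
  rw [Set.mem_setOf_eq] at hu
  rw [mem_closedBall, dist_zero_right]
  obtain ⟨m, hm, hpm, hmP⟩ := exists_pow_isPrincipal_not_dvd (p := p) hu
  rw [unitLog_eq_inv_mul_logSeries p hm hmP, norm_mul, norm_inv]
  have hm1 : ‖((m : ℕ) : K)‖ = 1 := by
    rw [norm_natCast_eq_padicNorm p K m, Padic.norm_natCast_eq_one_iff]
    exact (Nat.Prime.coprime_iff_not_dvd hp.out).mpr hpm
  rw [hm1, inv_one, one_mul]
  exact (norm_logSeries_le_of_isPrincipal p hϖ he hmP).trans (hϖ.norm_le_of_norm_lt_one _ hmP)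

/-- **Lower half of the sandwich: `𝔪² = {‖z‖ ≤ ‖ϖ‖²} ⊆ log_p(𝒪^×)`** at `e = p − 1` (successive
approximation inside `1 + 𝔪²`, where the contraction modulus is `‖ϖ‖ < 1`; the tree's
`closedBall_subset_logUnits_of_mul_rpow_lt_one`). [cite: NeukirchANT1999, Ch. II Prop. (5.5)] -/
theorem closedBall_sq_subset_logUnits : closedBall (0 : K) (‖(ϖ : K)‖ ^ 2) ⊆ logUnits K :=
  closedBall_subset_logUnits_of_mul_rpow_lt_one p (sq_mul_rpow_lt_one p hϖ he)

/-- `log_p` maps `1 + 𝔪²` ONTO `𝔪²`: every `z` with `‖z‖ ≤ ‖ϖ‖²` is `L(u)` with `‖1 − u‖ ≤ ‖ϖ‖²`.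
[cite: Koblitz1984, Ch. IV §2] -/
theorem exists_logSeries_eq_of_norm_le_sq {z : K} (hz : ‖z‖ ≤ ‖(ϖ : K)‖ ^ 2) :
    ∃ u : K, ‖1 - u‖ ≤ ‖(ϖ : K)‖ ^ 2 ∧ logSeries u = z :=
  exists_logSeries_eq p K (sq_mul_rpow_lt_one p hϖ he) hz

/-- `log_p` is INJECTIVE on `1 + 𝔪²` at `e = p − 1`. [cite: Koblitz1984, Ch. IV §2] -/
theorem logSeries_injOn_sq : Set.InjOn (logSeries (K := K)) {y : K | ‖1 - y‖ ≤ ‖(ϖ : K)‖ ^ 2} :=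
  logSeries_injOn p K (sq_mul_rpow_lt_one p hϖ he)

omit hp instK [IsUltrametricDist K] [ProperSpace K] he in
/-- Discreteness, in the form used below: an element of `𝔪 ∖ 𝔪²` has norm EXACTLY `‖ϖ‖`.
[cite: NeukirchANT1999, Ch. II Prop. (5.5)] -/
theorem norm_eq_of_sq_lt_of_le {z : K} (h1 : ‖(ϖ : K)‖ ^ 2 < ‖z‖) (h2 : ‖z‖ ≤ ‖(ϖ : K)‖) :
    ‖z‖ = ‖(ϖ : K)‖ := by
  have hr0 : 0 < ‖(ϖ : K)‖ := norm_units_pos ϖ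
  have hz0 : z ≠ 0 := by
    rintro rfl
    rw [norm_zero] at h1
    exact absurd h1 (not_lt.mpr (by positivity))
  obtain ⟨k, hk⟩ := hϖ.2 (Units.mk0 z hz0)
  rw [Units.val_mk0] at hk
  rw [hk] at h1 h2 ⊢
  have hk1 : 1 ≤ k := by
    by_contra hlt
    have : ‖(ϖ : K)‖ ^ (1 : ℤ) < ‖(ϖ : K)‖ ^ k :=
      zpow_lt_zpow_right_of_lt_one₀ hr0 hϖ.norm_lt_one (by omega)
    rw [zpow_one] at this
    exact absurd h2 (not_le.mpr this)
  have hk2 : k < 2 := by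
    by_contra hge
    have : ‖(ϖ : K)‖ ^ k ≤ ‖(ϖ : K)‖ ^ (2 : ℤ) :=
      zpow_le_zpow_right_of_le_one₀ hr0 hϖ.norm_lt_one.le (by omega)
    rw [zpow_ofNat] at this
    exact absurd h1 (not_lt.mpr this)
  have : k = 1 := by omega
  rw [this, zpow_one]

end Sandwich

end BoundaryRamification

end Literature.IUT.LogVolume

end
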